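import Mathlib
import HarnessLib
import Summits.ResolutionOfSingularities.ResolutionOfSingularities.Theorems.WildQuotientsWildQuotientResolutionCyclicTransferIsRegularGlued
import Summits.ResolutionOfSingularities.ResolutionOfSingularities.Theorems.WildQuotientsWildQuotientResolutionStubQuotientModel
import Summits.ResolutionOfSingularities.ResolutionOfSingularities.Theorems.WildQuotientsWildQuotientResolutionStubBirational
import Literature.AlgebraicGeometry.Resolution.ResolutionOfCurves
import Summits.ResolutionOfSingularities.ResolutionOfSingularities.Theorems.IndSmoothValuativeSmoothingSmoothBlowupChart
import Literature.AlgebraicGeometry.RelativeSpec.FiniteGroupQuotientGluedProperties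
import Literature.AlgebraicGeometry.Resolution.TameQuotientSingularitiesResolution
import Literature.AlgebraicGeometry.Resolution.ProjectiveSpaceRegular
import Literature.AlgebraicGeometry.Resolution.ComponentGluing

/-!
# The glued quotient `X′/G` has Bergh–Rydh charts; tame quotients modulo Bergh–Rydh
(route `ResolutionOfSingularities/WildQuotients`; chain w45c on crux
stmt-ResolutionOfSingularities-15640 `WildQuotientResolution`, sub-line T2; serves the support item
`TameQuotientResolution` stmt-ResolutionOfSingularities-15645)

[OURS · L1 W4.5c; NOT a statement of the manuscript.] CONDITIONAL on the named fact
`Literature.AlgebraicGeometry.Resolution.BerghRydh2019_tameQuotientResolution` (Bergh–Rydh 2019,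
Thm. 5, constant tame groups; an undischarged `def … : Prop`, taken as the hypothesis `hBR`).

The item `TameQuotientResolution` (Galois-type quotients `X₁` of a REGULAR integral `X′` by a
finite group `G` of order prime to `p` over a PERFECT field `k`; `q : X′ → X₁` finite, surjective,
generically étale, `G`-invariant, fibres = orbits) is the named fact up to one piece of glue that
the tree's `Theorems/WildQuotientsTameQuotientResolution.lean` names as missing ("the
identification of `X′/G → X₁` as a birational (normalisation) map"). This file supplies it:

* `exists_tame_chart` — **the glued quotient `X/G` has Bergh–Rydh charts.** For an action `ρ`
  of a finite group `G` on a regular `X` over a separated locally Noetherian `Y` (`r : X → Y`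
  separated, locally of finite type) and a `k`-structure `f : Y → Spec k` locally of finite
  type, every point of `X/G = ρ.glued` lies in an OPEN chart `Spec S^G ↪ X/G` OVER `k`, where
  `S = Γ(O, (O ↪ X → Y)⁻¹U)` (`O ⊆ X` a `G`-stable open affine over `Y`, `U ⊆ Y` affine open) is
  a regular `k`-algebra of finite type acted on by `G` through `k`-algebra automorphisms and
  `S^G = FixedPoints.subalgebra k S G`: the chart is `Spec S^G ≅ Spec Γ(O, r⁻¹U)^G ↪ O/G ↪ X/G`
  (`CyclicTransfer.exists_chart_apply_eq`), and its compatibility with the `k`-structures is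
  `ActionOver.gluedι_gluedDesc_base` + `SubringDatum.ι_fromSpec` + `IsAffineOpen.SpecMap_appLE_fromSpec`.
* `hasResolution_glued_of_berghRydh` — hence, over a perfect `k` and for `|G| ∈ kˣ`, `X/G` has
  a resolution (Bergh–Rydh; regular of finite type over perfect = smooth,
  `ValuativeSmoothing.smooth_of_isRegularRing_of_perfectField`).
* `hasResolution_of_faithful_of_berghRydh` — the item for a FAITHFUL action: `X′/G → X₁` is
  proper (`ActionOver.isProper_gluedDesc`) and birational (the `W`-clause
  `QuotientModel.exists_dense_isFinite_etale_bijective` + lemma (L)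
  `Birational.stub_birational_of_bijective`, in positive dimension; dimension `0` by
  `hasResolution_of_dim_le_one`), so resolutions transfer (`Scheme.HasResolution.of_isBirational`).
* The item itself (`BerghRydh2019_tameQuotientResolution → Theses.WildQuotients.TameQuotientResolution`,
  by passing to the faithful quotient `G ⧸ ker ρ`) is derived in the route-dependent file
  `Theorems/WildQuotientsTameQuotientResolutionOfBerghRydh.lean`; this file is route-independent.
-/

-- single-problem summit: the doubled namespace component `ResolutionOfSingularities` is forced
set_option linter.dupNamespace false

noncomputable section

open CategoryTheory Limits AlgebraicGeometry TopologicalSpace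
open Literature.AlgebraicGeometry.Resolution Literature.AlgebraicGeometry.RelativeSpec

namespace Summit.ResolutionOfSingularities.ResolutionOfSingularities.Theorems.WildQuotientResolution.TameQuotient

/-- **The glued quotient `X/G` has Bergh–Rydh charts over `k`.** Let a finite group `G` act
(`ρ`) on a regular locally Noetherian scheme `X` over a separated locally Noetherian base `Y`
(`r : X → Y` separated and locally of finite type), and let `f : Y → Spec k` be locally of
finite type. Then every point `z` of the glued quotient `X/G = ρ.glued` lies in the image of an
OPEN IMMERSION `φ : Spec S^G ↪ X/G` with `φ ≫ (X/G → Y → Spec k) = Spec (k → S^G)`, where `S`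
is a regular `k`-algebra of finite type with a `G`-action by `k`-algebra automorphisms and
`S^G = FixedPoints.subalgebra k S G`. Construction: `z` lies in a chart
`Spec Γ(O, r′⁻¹U)^G ↪ O/G ↪ X/G` (`O` a `G`-stable open of `X` affine over `Y`,
`r′ = O ↪ X → Y`, `U ⊆ Y` affine open; `CyclicTransfer.exists_chart_apply_eq`); take
`S = Γ(O, r′⁻¹U)` — regular (`Scheme.IsRegular.isRegularRing_of_isAffineOpen`), of finite type
over `Γ(Y, U)` hence over `k`, with `G` acting by `ActionOver.act` and `k → Γ(Y, U) → S` landing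
in the invariants (`ActionOver.act_app`); `Γ(O, r′⁻¹U)^G = S^G` tautologically, and the chart
followed by `X/G → Y` is `Spec (Γ(Y,U) → S^G) ≫ (U ↪ Y)` (`gluedι_gluedDesc_base`,
`SubringDatum.ι_fromSpec`), whose composite with `f` is `Spec` of `k → Γ(Y, U) → S^G`
(`IsAffineOpen.SpecMap_appLE_fromSpec`). [cite: SGA1, Exp. V, §1, Prop. 1.8]
[cite: MumfordAV1970, §7 Thm. p. 66] -/
theorem exists_tame_chart {X Y : Scheme.{0}} {r : X ⟶ Y} {G : Type} [Group G] [Finite G]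
    (ρ : ActionOver r G) [Y.IsSeparated] [IsSeparated r] [LocallyOfFiniteType r]
    [IsLocallyNoetherian Y] [IsLocallyNoetherian X] (hreg : Scheme.IsRegular X)
    (k : Type) [Field k] (f : Y ⟶ Spec (.of k)) [LocallyOfFiniteType f] (z : ρ.glued) :
    ∃ (S : Type) (_ : CommRing S) (_ : Algebra k S) (_ : MulSemiringAction G S)
      (_ : SMulCommClass G k S),
      Algebra.FiniteType k S ∧ IsRegularRing S ∧
      ∃ φ : Spec (.of (FixedPoints.subalgebra k S G)) ⟶ ρ.glued,
        IsOpenImmersion φ ∧ z ∈ Set.range φ.base ∧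
        φ ≫ ρ.gluedDesc r ρ.aut_comp ≫ f =
          Spec.map (CommRingCat.ofHom (algebraMap k (FixedPoints.subalgebra k S G))) := by
  classical
  obtain ⟨O, U, pt, hpt⟩ := CyclicTransfer.exists_chart_apply_eq ρ z
  -- the restricted action on the stable affine `O`, over `Y` through `r' = O ↪ X → Y`
  let ρ' := ρ.restrict O.1 O.2.1
  let r' : (O.1 : Scheme.{0}) ⟶ Y := O.1.ι ≫ r
  have hU' : IsAffineOpen (r' ⁻¹ᵁ U.1) := U.2.preimage r'
  -- the chart ring `S = Γ(O, r'⁻¹ U)` with its `k`-algebra structure through `Γ(Y, U)`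
  let S : Type := Γ(O.1, r' ⁻¹ᵁ U.1)
  let κ₀ : CommRingCat.of k ⟶ Γ(Y, U.1) :=
    (Scheme.ΓSpecIso (.of k)).inv ≫ f.appLE ⊤ U.1 le_top
  letI algkS : Algebra k S := ((r'.app U.1).hom.comp κ₀.hom).toAlgebra
  letI actS : MulSemiringAction G S := ρ'.mulSemiringAction U.1
  have hsmul : ∀ (g : G) (s : S), g • s = ρ'.act g U.1 s := fun g s => rfl
  haveI commS : SMulCommClass G k S := ⟨fun g c s => by
    rw [Algebra.smul_def, Algebra.smul_def, hsmul, hsmul, map_mul]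
    congr 1
    exact ρ'.act_app g U.1 (κ₀ c)⟩
  -- finite type over `k`
  have hft : Algebra.FiniteType k S := by
    rw [← RingHom.finiteType_algebraMap]
    change ((r'.app U.1).hom.comp κ₀.hom).FiniteType
    refine RingHom.FiniteType.comp ?_ ?_
    · have h := r'.finiteType_appLE U.2 hU' le_rfl
      rwa [← Scheme.Hom.app_eq_appLE] at h
    · change ((f.appLE ⊤ U.1 le_top).hom.comp (Scheme.ΓSpecIso (.of k)).inv.hom).FiniteType
      exact RingHom.FiniteType.comp (f.finiteType_appLE (isAffineOpen_top _) U.2 le_top)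
        (RingHom.FiniteType.of_surjective _
          (Scheme.ΓSpecIso (.of k)).commRingCatIsoToRingEquiv.symm.surjective)
  -- regular
  have hregO : Scheme.IsRegular (O.1 : Scheme.{0}) := fun y => by
    haveI := hreg (O.1.ι.base y)
    exact IsRegularLocalRing.of_ringEquiv (asIso (O.1.ι.stalkMap y)).commRingCatIsoToRingEquiv
  haveI : IsLocallyNoetherian (O.1 : Scheme.{0}) := inferInstance
  have hSreg : IsRegularRing S := hregO.isRegularRing_of_isAffineOpen hU'
  -- the ring of invariants is `S^G`
  let e : ρ'.invariants.ring U.1 ≃+* FixedPoints.subalgebra k S G :=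
    { toFun := fun x => ⟨x.1, x.2⟩
      invFun := fun x => ⟨x.1, x.2⟩
      left_inv := fun _ => rfl
      right_inv := fun _ => rfl
      map_mul' := fun _ _ => rfl
      map_add' := fun _ _ => rfl }
  let ε : CommRingCat.of (ρ'.invariants.ring U.1) ⟶ CommRingCat.of (FixedPoints.subalgebra k S G) :=
    CommRingCat.ofHom e.toRingHom
  haveI : IsIso ε := (e.toCommRingCatIso).isIso_hom
  -- the chart `Spec S^G ≅ Spec Γ(O, r'⁻¹U)^G ↪ O/G ↪ X/G`
  let χ : Spec (.of (ρ'.invariants.ring U.1)) ⟶ ρ.glued :=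
    ρ'.invariants.openCover.f U ≫ ρ.gluedι O
  have hχ0 : IsOpenImmersion (ρ'.invariants.openCover.f U ≫ ρ.gluedι O) := inferInstance
  have hχ : IsOpenImmersion χ := hχ0
  -- compatibility of the chart with the `k`-structures
  have h1 : ρ.gluedι O ≫ ρ.gluedDesc r ρ.aut_comp = ρ'.invariants.fromSpec :=
    ρ.gluedι_gluedDesc_base O
  have h2 : U.2.fromSpec ≫ f =
      Spec.map (f.appLE ⊤ U.1 le_top) ≫ Spec.map (Scheme.ΓSpecIso (.of k)).inv := by
    rw [← Scheme.isoSpec_Spec_inv, ← IsAffineOpen.fromSpec_top]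
    exact (IsAffineOpen.SpecMap_appLE_fromSpec f (isAffineOpen_top _) U.2 le_top).symm
  have h2' : (Spec.map (ρ'.invariants.diagramMap.app (.op U.1)) ≫ U.2.fromSpec) ≫ f =
      Spec.map (κ₀ ≫ ρ'.invariants.diagramMap.app (.op U.1)) := by
    rw [Category.assoc, h2, ← Spec.map_comp, ← Spec.map_comp]
  have h3 : ρ'.invariants.openCover.f U ≫ ρ.gluedι O ≫ ρ.gluedDesc r ρ.aut_comp ≫ f =
      Spec.map (κ₀ ≫ ρ'.invariants.diagramMap.app (.op U.1)) := by
    rw [reassoc_of% h1, ρ'.invariants.ι_fromSpec_assoc U]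
    exact h2' 
  have h3' : χ ≫ ρ.gluedDesc r ρ.aut_comp ≫ f =
      Spec.map (κ₀ ≫ ρ'.invariants.diagramMap.app (.op U.1)) := h3
  let φ : Spec (.of (FixedPoints.subalgebra k S G)) ⟶ ρ.glued := Spec.map ε ≫ χ
  have hφ : IsOpenImmersion φ := by
    dsimp only [φ]
    infer_instance
  refine ⟨S, inferInstance, algkS, actS, commS, hft, hSreg, φ, hφ, ?_, ?_⟩
  · -- `z` is in the image
    obtain ⟨pt', rfl⟩ := (Spec.map ε).homeomorph.surjective pt
    refine ⟨pt', ?_⟩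
    rw [← hpt]
    rfl
  · -- compatibility with the `k`-structures
    change (Spec.map ε ≫ χ) ≫ ρ.gluedDesc r ρ.aut_comp ≫ f = _
    rw [Category.assoc, h3']
    refine (Spec.map_comp _ _).symm.trans ?_
    congr 1

/-- **`X/G` has a resolution over a perfect field when `|G| ∈ kˣ`, modulo Bergh–Rydh.** With
the data of `exists_tame_chart`, `k` perfect and `(|G| : k) ≠ 0`, if `X/G` is integral and
`X/G → Y → Spec k` is separated, quasi-compact and locally of finite type, then `X/G` has a
resolution of singularities: its Bergh–Rydh charts have REGULAR chart algebras of finite type,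
which are smooth over the perfect `k` (`ValuativeSmoothing.smooth_of_isRegularRing_of_perfectField`),
so the named fact `BerghRydh2019_tameQuotientResolution` (hypothesis `hBR`) applies.
CONDITIONAL on that named fact. [cite: BerghRydh2019, Thm 5 (arXiv:1905.00872, p. 4)] -/
theorem hasResolution_glued_of_berghRydh (hBR : BerghRydh2019_tameQuotientResolution)
    {X Y : Scheme.{0}} {r : X ⟶ Y} {G : Type} [Group G] [Finite G]
    (ρ : ActionOver r G) [Y.IsSeparated] [IsSeparated r] [LocallyOfFiniteType r]
    [IsLocallyNoetherian Y] [IsLocallyNoetherian X] (hreg : Scheme.IsRegular X)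
    (k : Type) [Field k] [PerfectField k] (f : Y ⟶ Spec (.of k)) [LocallyOfFiniteType f]
    (hG : (Nat.card G : k) ≠ 0) [IsIntegral ρ.glued]
    [IsSeparated (ρ.gluedDesc r ρ.aut_comp ≫ f)]
    [LocallyOfFiniteType (ρ.gluedDesc r ρ.aut_comp ≫ f)]
    [QuasiCompact (ρ.gluedDesc r ρ.aut_comp ≫ f)] :
    Scheme.HasResolution ρ.glued :=
  hBR k ρ.glued (ρ.gluedDesc r ρ.aut_comp ≫ f) fun z => by
    obtain ⟨S, _, _, _, _, hft, hSreg, φ, hφ, hz, hcomp⟩ := exists_tame_chart ρ hreg k f z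
    haveI := hft
    haveI := hSreg
    haveI := hφ
    exact ⟨G, inferInstance, inferInstance, S, inferInstance, inferInstance, inferInstance,
      inferInstance, hG, hft, ValuativeSmoothing.smooth_of_isRegularRing_of_perfectField k S, φ,
      inferInstance, hz, hcomp⟩

/-- **`TameQuotientResolution` for a faithful action, modulo Bergh–Rydh.** Binders of the crux
`WildQuotientResolution` over a PERFECT field `k`, with `ρ` faithful and `|G|` prime to `p`:
`X₁` has a resolution of singularities. In dimension `0` by `hasResolution_of_dim_le_one`; else the glued
quotient `Y₁ = X′/G` over `X₁` (the `G`-stable affine cover of `X′` is by the preimages of the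
affine opens of `X₁` under the finite `G`-invariant `q`) is integral, `r : Y₁ → X₁` is proper
(`ActionOver.isProper_gluedDesc`) and birational (finite étale bijective over a dense open by the
`W`-clause `QuotientModel.exists_dense_isFinite_etale_bijective`, then lemma (L)
`Birational.stub_birational_of_bijective`), `Y₁` has a resolution by
`hasResolution_glued_of_berghRydh`, and resolutions transfer along `r`
(`Scheme.HasResolution.of_isBirational`). CONDITIONAL on `BerghRydh2019_tameQuotientResolution`.
[cite: BerghRydh2019, Thm 5 (arXiv:1905.00872, p. 4)] [cite: SGA1, Exp. V, §1–2] -/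
theorem hasResolution_of_faithful_of_berghRydh (hBR : BerghRydh2019_tameQuotientResolution)
    {p : ℕ} (hp : p.Prime) (k : Type) [Field k] [CharP k p] [PerfectField k]
    (X' X₁ : Scheme.{0}) (f : X₁ ⟶ Spec (.of k)) (q : X' ⟶ X₁) (G : Type) [Group G] [Finite G]
    (ρ : G →* Aut X') (hcop : Nat.Coprime (Nat.card G) p) (hfaith : Function.Injective ρ)
    [IsSeparated f] [LocallyOfFiniteType f] [QuasiCompact f] [IsIntegral X₁] [IsIntegral X']
    (hreg : Scheme.IsRegular X') [IsFinite q] (hsurj : Function.Surjective q.base)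
    (hU : ∃ U : X₁.Opens, Dense (U : Set X₁) ∧ Etale (q ∣_ U))
    (hρ : ∀ g : G, (ρ g).hom ≫ q = q)
    (horb : ∀ x y : X', q.base x = q.base y → ∃ g : G, (ρ g).hom.base x = y) :
    Scheme.HasResolution X₁ := by
  classical
  by_cases hdim : topologicalKrullDim X₁ ≤ 0
  · exact hasResolution_of_dim_le_one X₁ f (hdim.trans zero_le_one)
  -- separatedness and noetherianity
  haveI : X₁.IsSeparated := ⟨by rw [← terminal.comp_from f]; infer_instance⟩
  haveI : X'.IsSeparated := ⟨by rw [← terminal.comp_from (q ≫ f)]; infer_instance⟩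
  haveI : IsLocallyNoetherian X₁ := LocallyOfFiniteType.isLocallyNoetherian f
  haveI : IsLocallyNoetherian X' := LocallyOfFiniteType.isLocallyNoetherian (q ≫ f)
  -- the action over `X₁` (through `𝟙 ≫ q`, the format of the quotient-model glue)
  let ρB : ActionOver (𝟙 X' ≫ q) G := ⟨ρ, fun g => by rw [Category.id_comp]; exact hρ g⟩
  -- `G`-stable affine cover: preimages of affine opens of `X₁`
  have hcov' : ∀ x : X', ∃ O : ρB.StableAffineOpens, x ∈ O.1 := by
    intro x
    obtain ⟨U, hUaff, hxU, -⟩ := exists_isAffineOpen_mem_and_subset (X := X₁) (x := q.base x)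
      (U := ⊤) (Opens.mem_top _)
    haveI : IsAffine (q ⁻¹ᵁ U : X'.Opens) := hUaff.preimage q
    refine ⟨⟨q ⁻¹ᵁ U, fun g => ?_, isAffineHom_of_isAffine_of_isSeparated _⟩, hxU⟩
    change (ρ g).hom ⁻¹ᵁ (q ⁻¹ᵁ U) = q ⁻¹ᵁ U
    rw [← Scheme.Hom.comp_preimage, hρ g]
  have hinj : Function.Injective ρB.aut := hfaith
  -- the quotient `Y₁ := X′/G → X₁`, proper and birational
  haveI hY₁ : IsIntegral ρB.glued := ρB.isIntegral_glued hcov'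
  haveI hr : IsProper (ρB.gluedDesc (𝟙 X' ≫ q) ρB.aut_comp) :=
    ρB.isProper_gluedDesc hcov' (𝟙 X' ≫ q) ρB.aut_comp (𝟙 X₁) (Category.comp_id _)
  have hbir1 : IsBirational (𝟙 X') := ⟨⊤, by simp, by simp, inferInstance⟩
  obtain ⟨W, hWd, hWfin, hWet, hWbij⟩ :=
    QuotientModel.exists_dense_isFinite_etale_bijective (𝟙 X') q ρB hcov' hinj ρ
      (fun g => by
        change (ρ g).hom ≫ 𝟙 X' = 𝟙 X' ≫ (ρ g).hom
        rw [Category.comp_id, Category.id_comp])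
      horb hsurj hU hbir1
  haveI := hWfin
  haveI := hWet
  have hrbir : IsBirational (ρB.gluedDesc (𝟙 X' ≫ q) ρB.aut_comp) :=
    Birational.stub_birational_of_bijective k f (ρB.gluedDesc (𝟙 X' ≫ q) ρB.aut_comp) hdim W hWd
      hWbij
  -- `Y₁` has a resolution by Bergh–Rydh, and resolutions transfer along `r`
  have hGk : (Nat.card G : k) ≠ 0 := fun h =>
    hp.ne_one (hcop.symm.eq_one_of_dvd ((CharP.cast_eq_zero_iff k p _).mp h))
  have hY₁res : Scheme.HasResolution ρB.glued :=
    hasResolution_glued_of_berghRydh hBR ρB hreg k f hGk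
  exact ComponentGluing.Scheme.HasResolution.of_isBirational
    (ρB.gluedDesc (𝟙 X' ≫ q) ρB.aut_comp) hrbir hY₁res

end Summit.ResolutionOfSingularities.ResolutionOfSingularities.Theorems.WildQuotientResolution.TameQuotient

end
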